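import Summits.QuantumFields.GaugeBoot.DiagonalRPTorusColumnPairs
import HarnessLib

/-!
# Fins: minimal covers of two non-adjacent columns (gauge-boot, task L3(π), 3/7)

HONEST FRAMING (cell `pub-gaugeboot`, page 1 of every file): the venture produces certified bounds
on lattice expectations at stated coupling, gauge group, dimension and torus size; NOT a mass gap,
NOT a continuum limit, NOT a string tension; NOT Yang–Mills-summit-bearing (barriers
`FixedCouplingUltralocality`, `PerturbativeInvisibility`). This module is combinatorial
bookkeeping for the structural NEGATIVE result `DiagonalRPTorusInnerHalfNegativeEvenSUN`
(inner-half diagonal RP fails on even three-tori for `G ≅ SU(N)` at small coupling); it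
discharges nothing by itself.

## Content (torus `(ℤ/L)³`, spectator direction `2`)

Let `A ≠ B` be non-adjacent columns and `S` a set of plaquettes covering both (`DiagRPSUN.Covers`)
with `|S| ≤ 2L`. Then (`exists_fins`) `S` consists of exactly `2L` FINS: one plaquette `f_A(z)`
through each vertical link over `A` and one `f_B(z)` through each vertical link over `B`. A fin
through the link over `A` at height `z` has an OUTER column `O` adjacent to `A` whose vertical
link at height `z` it also contains (`exists_outer`). Consequences:

* **`exists_lonely_of_sep`** — if `A`, `B` are separated (`DiagRPSUN.Sep`: no common neighbour),
  some plaquette of `S` has a LONELY LINK: a link in no other plaquette of `S` and in neither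
  column;
* `band B pl = ladder B pl ∪ ladder (B + e_a) pl` (`pl = (a, 2)`), `card_band` (`= 2L`);
* **`exists_lonely_of_ne_band`** — for the pair `(B + 2e_a, B)` (`L ≥ 5`), every such `S` other
  than the band has a lonely link (a lonely-free `S` has all outer columns equal to the unique
  common neighbour `B + e_a`, `DiagRPSUN.eq_bump_of_adj_adj`, and is then the band by
  `DiagRPSUN.eq_rung_of_pcnt`).

With the lonely-link reduction (`DiagonalRPTorusLonelyLink`) these say: below order `2L + 1` the
only non-vanishing cluster term of a pair of columns at distance two is the band, and there is
none for a separated pair. Elementary; no named fact.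
-/

open Finset Function

namespace Summit.QuantumFields.GaugeBoot

open Literature.MathematicalPhysics.QuantumFieldTheory

noncomputable section

namespace DiagRPSUN

open DiagRPThree DiagRPPolyakov

section Fins

variable {L : ℕ}

/-! ## Links of a plaquette, outer columns -/

/-- A plaquette contains its second defining link. -/
theorem pcnt_link2_ne_zero (p : Plaquette 3 L) : pcnt p (p.1.shift p.2.1.1, p.2.1.2) ≠ 0 := by
  unfold pcnt
  rw [if_pos (rfl : (p.1.shift p.2.1.1, p.2.1.2) = _)]
  omega

/-- A plaquette contains its fourth defining link. -/
theorem pcnt_link4_ne_zero (p : Plaquette 3 L) : pcnt p (p.1, p.2.1.2) ≠ 0 := by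
  unfold pcnt
  rw [if_pos (rfl : (p.1, p.2.1.2) = _)]
  omega

/-- Shifting sites is injective. -/
theorem shift_injective (i : Fin 3) {x y : Site 3 L} (h : x.shift i = y.shift i) : x = y :=
  add_right_cancel h

/-- The column indicator vanishes on vertical links over another column. -/
theorem ccnt_vsite_of_ne {A O : ZMod L × ZMod L} (h : O ≠ A) (z : ZMod L) :
    ccnt A (vsite O z, 2) = 0 := by
  unfold ccnt
  rw [if_neg]
  rintro ⟨-, h0, h1⟩
  exact h (Prod.ext h0 h1)

/-- **The outer column of a fin**: a plaquette through the vertical link over `A` at height `z`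
also contains the vertical link at height `z` over a column `O ≠ A` adjacent to `A` (`L ≥ 2`). -/
theorem exists_outer (hL : 1 < L) {p : Plaquette 3 L} {A : ZMod L × ZMod L} {z : ZMod L}
    (h : pcnt p (vsite A z, 2) ≠ 0) :
    ∃ O : ZMod L × ZMod L, Adj A O ∧ O ≠ A ∧ pcnt p (vsite O z, 2) ≠ 0 := by
  have hi := plaq_fst_ne_two p
  obtain ⟨hj, hy⟩ := vertical_of_pcnt_ne_zero h
  rcases hy with hy | hy
  · -- `A` sits over `x + e_i`: the outer column is `A - e_i`, over `x`
    refine ⟨unbump p.2.1.1 A, ⟨p.2.1.1, hi, Or.inr (bump_unbump _ _).symm⟩, fun hO => ?_, ?_⟩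
    · have hb := bump_ne_self hL hi (unbump p.2.1.1 A)
      rw [bump_unbump] at hb
      exact hb hO.symm
    · have hx : p.1 = vsite (unbump p.2.1.1 A) z := by
        apply shift_injective p.2.1.1
        rw [vsite_shift_of_ne_two _ z hi, bump_unbump, hy]
      have h4 := pcnt_link4_ne_zero p
      rwa [hx, hj] at h4
  · -- `A` sits over `x`: the outer column is `A + e_i`, over `x + e_i`
    refine ⟨bump p.2.1.1 A, ⟨p.2.1.1, hi, Or.inl rfl⟩, bump_ne_self hL hi A, ?_⟩
    have h2 := pcnt_link2_ne_zero p
    rwa [← hy, vsite_shift_of_ne_two A z hi, hj] at h2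

/-- Two vertical links of one plaquette have the same height. -/
theorem height_eq_of_pcnt_ne_zero₂ {p : Plaquette 3 L} {A O : ZMod L × ZMod L} {w z : ZMod L}
    (hA : pcnt p (vsite A w, 2) ≠ 0) (hO : pcnt p (vsite O z, 2) ≠ 0) : w = z :=
  (height_eq_of_pcnt_ne_zero hA).symm.trans (height_eq_of_pcnt_ne_zero hO)

variable [NeZero L]

/-! ## Fins -/

/-- **Fins.** Two distinct non-adjacent columns covered by at most `2L` plaquettes: `S` is exactly
one fin per vertical link of each column. -/
theorem exists_fins {S : Finset (Plaquette 3 L)} {A B : ZMod L × ZMod L} (hAB : A ≠ B)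
    (hn : ¬ Adj A B) (hA : Covers S A) (hB : Covers S B) (hcard : S.card ≤ 2 * L) :
    ∃ fA fB : ZMod L → Plaquette 3 L,
      (∀ z, fA z ∈ S ∧ pcnt (fA z) (vsite A z, 2) ≠ 0) ∧
        (∀ z, fB z ∈ S ∧ pcnt (fB z) (vsite B z, 2) ≠ 0) ∧
          ∀ p ∈ S, (∃ z, p = fA z) ∨ (∃ z, p = fB z) := by
  classical
  choose fA hfAS hfA using hA
  choose fB hfBS hfB using hB
  set g : ZMod L ⊕ ZMod L → Plaquette 3 L := Sum.elim fA fB with hg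
  have hinj : Function.Injective g := by
    rintro (z | z) (w | w) h
    · simp only [hg, Sum.elim_inl] at h
      rw [height_eq_of_pcnt_ne_zero₂ (hfA z) (h ▸ hfA w)]
    · simp only [hg, Sum.elim_inl, Sum.elim_inr] at h
      exact absurd (eq_or_adj_of_pcnt_ne_zero (hfA z) (h ▸ hfB w)) (not_or.2 ⟨hAB, hn⟩)
    · simp only [hg, Sum.elim_inl, Sum.elim_inr] at h
      exact absurd (eq_or_adj_of_pcnt_ne_zero (hfA w) (h.symm ▸ hfB z)) (not_or.2 ⟨hAB, hn⟩)
    · simp only [hg, Sum.elim_inr] at h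
      rw [height_eq_of_pcnt_ne_zero₂ (hfB z) (h ▸ hfB w)]
  have hsub : univ.image g ⊆ S := by
    rintro p hp
    obtain ⟨x, -, rfl⟩ := mem_image.1 hp
    rcases x with z | z
    · exact hfAS z
    · exact hfBS z
  have hcardg : (univ.image g).card = 2 * L := by
    rw [card_image_of_injective _ hinj, card_univ, Fintype.card_sum, ZMod.card]; ring
  have himg : univ.image g = S := eq_of_subset_of_card_le hsub (by rw [hcardg]; exact hcard)
  refine ⟨fA, fB, fun z => ⟨hfAS z, hfA z⟩, fun z => ⟨hfBS z, hfB z⟩, fun p hp => ?_⟩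
  rw [← himg, mem_image] at hp
  obtain ⟨x, -, rfl⟩ := hp
  rcases x with z | z
  · exact Or.inl ⟨z, rfl⟩
  · exact Or.inr ⟨z, rfl⟩

omit [NeZero L] in
/-- **Where a link over an outer column can go.** With fins `f_A, f_B` as in `exists_fins`, a
plaquette `q ∈ S`, `q ≠ f_A(z)`, through the vertical link at height `z` over a column `O ≠ B`
is `f_B(z)`, and then `O` is adjacent to `B`. -/
theorem adj_of_fin {S : Finset (Plaquette 3 L)} {A B O : ZMod L × ZMod L}
    {fA fB : ZMod L → Plaquette 3 L} (hfA : ∀ z, fA z ∈ S ∧ pcnt (fA z) (vsite A z, 2) ≠ 0)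
    (hfB : ∀ z, fB z ∈ S ∧ pcnt (fB z) (vsite B z, 2) ≠ 0)
    (hfins : ∀ p ∈ S, (∃ z, p = fA z) ∨ (∃ z, p = fB z)) (hOB : O ≠ B) {z : ZMod L}
    {q : Plaquette 3 L} (hqS : q ∈ S) (hq : q ≠ fA z) (hqO : pcnt q (vsite O z, 2) ≠ 0) :
    q = fB z ∧ Adj O B := by
  rcases hfins q hqS with ⟨w, rfl⟩ | ⟨w, rfl⟩
  · exact absurd (congrArg fA (height_eq_of_pcnt_ne_zero₂ (hfA w).2 hqO)) hq
  · have hwz : w = z := height_eq_of_pcnt_ne_zero₂ (hfB w).2 hqO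
    subst hwz
    refine ⟨rfl, ?_⟩
    rcases eq_or_adj_of_pcnt_ne_zero hqO (hfB w).2 with h | h
    · exact absurd h hOB
    · exact h

/-! ## Separated pairs: a lonely link -/

/-- **A separated pair has a lonely link.** If `A`, `B` are separated (no common neighbour) and
covered by `S` with `|S| ≤ 2L`, then some `p ∈ S` has a link in no other plaquette of `S` and in
neither column (`L ≥ 2`). -/
theorem exists_lonely_of_sep (hL : 1 < L) {S : Finset (Plaquette 3 L)} {A B : ZMod L × ZMod L}
    (hsep : Sep A B) (hA : Covers S A) (hB : Covers S B) (hcard : S.card ≤ 2 * L) :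
    ∃ p ∈ S, ∃ ℓ : Edge 3 L, pcnt p ℓ ≠ 0 ∧ ccnt A ℓ = 0 ∧ ccnt B ℓ = 0 ∧
      ∀ q ∈ S, q ≠ p → pcnt q ℓ = 0 := by
  obtain ⟨fA, fB, hfA, hfB, hfins⟩ := exists_fins (ne_of_sep hsep) (not_adj_of_sep hsep) hA hB hcard
  obtain ⟨O, hAO, hOA, hO⟩ := exists_outer hL (hfA 0).2
  have hOB : O ≠ B := fun h => not_adj_of_sep hsep (h ▸ hAO)
  refine ⟨fA 0, (hfA 0).1, (vsite O 0, 2), hO, ccnt_vsite_of_ne hOA 0, ccnt_vsite_of_ne hOB 0,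
    fun q hqS hq => ?_⟩
  by_contra hqO
  exact not_adj_adj_of_sep hsep O hAO (adj_of_fin hfA hfB hfins hOB hqS hq hqO).2

/-! ## The pair `(B + 2e_a, B)`: the band or a lonely link -/

/-- The BAND of the vertical plane `pl = (a, 2)` over `B`: the two ladders based over `B` and over
`B + e_a` (the `2L` plaquettes between the columns `B`, `B + e_a`, `B + 2e_a`). -/
def band (B : ZMod L × ZMod L) (pl : {q : Fin 3 × Fin 3 // q.1 < q.2}) : Finset (Plaquette 3 L) :=
  ladder B pl ∪ ladder (bump pl.1.1 B) pl

/-- A ladder has exactly `L` plaquettes. -/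
theorem card_ladder (B : ZMod L × ZMod L) (pl : {q : Fin 3 × Fin 3 // q.1 < q.2}) :
    (ladder B pl).card = L := by
  unfold ladder
  rw [card_image_of_injective _ fun z w h => (vsite_eq_vsite_iff.1 (congrArg Prod.fst h)).2,
    card_univ, ZMod.card]

/-- Membership in a ladder. -/
theorem mem_ladder {B : ZMod L × ZMod L} {pl : {q : Fin 3 × Fin 3 // q.1 < q.2}}
    {p : Plaquette 3 L} : p ∈ ladder B pl ↔ ∃ z : ZMod L, p = (vsite B z, pl) := by
  unfold ladder
  simp only [mem_image, mem_univ, true_and, eq_comm]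

/-- The two ladders of a band are disjoint (`L ≥ 2`). -/
theorem disjoint_ladders (hL : 1 < L) (B : ZMod L × ZMod L) (pl : {q : Fin 3 × Fin 3 // q.1 < q.2})
    (hpl : pl.1.2 = 2) : Disjoint (ladder B pl) (ladder (bump pl.1.1 B) pl) := by
  rw [disjoint_left]
  intro p hp hq
  obtain ⟨z, rfl⟩ := mem_ladder.1 hp
  obtain ⟨w, hw⟩ := mem_ladder.1 hq
  exact bump_ne_self hL (fst_ne_two pl hpl) B (vsite_eq_vsite_iff.1 (congrArg Prod.fst hw)).1.symm

/-- **A band has `2L` plaquettes** (`L ≥ 2`). -/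
theorem card_band (hL : 1 < L) (B : ZMod L × ZMod L) (pl : {q : Fin 3 × Fin 3 // q.1 < q.2})
    (hpl : pl.1.2 = 2) : (band B pl).card = 2 * L := by
  unfold band
  rw [card_union_of_disjoint (disjoint_ladders hL B pl hpl), card_ladder, card_ladder]
  ring

/-- **The pair `(B + 2e_a, B)`: the band or a lonely link** (`L ≥ 5`). If `S ≠ band B pl`
covers both `B + 2e_a` and `B` with `|S| ≤ 2L`, some `p ∈ S` has a link in no other plaquette of
`S` and in neither column. -/
theorem exists_lonely_of_ne_band (hL : 5 ≤ L) (pl : {q : Fin 3 × Fin 3 // q.1 < q.2})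
    (hpl : pl.1.2 = 2) (B : ZMod L × ZMod L) {S : Finset (Plaquette 3 L)}
    (hA : Covers S (bump pl.1.1 (bump pl.1.1 B))) (hB : Covers S B) (hcard : S.card ≤ 2 * L)
    (hS : S ≠ band B pl) :
    ∃ p ∈ S, ∃ ℓ : Edge 3 L, pcnt p ℓ ≠ 0 ∧ ccnt (bump pl.1.1 (bump pl.1.1 B)) ℓ = 0 ∧
      ccnt B ℓ = 0 ∧ ∀ q ∈ S, q ≠ p → pcnt q ℓ = 0 := by
  have hL1 : 1 < L := by omega
  have hL3 : 3 ≤ L := by omega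
  have ha := fst_ne_two pl hpl
  set a := pl.1.1 with ha_def
  set A := bump a (bump a B) with hAdef
  set M := bump a B with hMdef
  have hAB : A ≠ B := bump_bump_ne_self hL3 ha B
  have hn : ¬ Adj A B := not_adj_bump_bump hL ha B
  obtain ⟨fA, fB, hfA, hfB, hfins⟩ := exists_fins hAB hn hA hB hcard
  by_contra H
  push Not at H
  -- every fin over `A` is the rung plaquette over `M`
  have hfAeq : ∀ z, fA z = (vsite M z, pl) := by
    intro z
    obtain ⟨O, hAO, hOA, hO⟩ := exists_outer hL1 (hfA z).2
    have hOB : O ≠ B := fun h => hn (h ▸ hAO)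
    obtain ⟨q, hqS, hq, hqO⟩ := H (fA z) (hfA z).1 (vsite O z, 2) hO (ccnt_vsite_of_ne hOA z)
      (ccnt_vsite_of_ne hOB z)
    have hOM : O = M := eq_bump_of_adj_adj hL ha hAO (adj_of_fin hfA hfB hfins hOB hqS hq hqO).2
    rw [hOM] at hO
    exact eq_rung_of_pcnt hL3 pl hpl M hO (hfA z).2
  -- every fin over `B` is the rung plaquette over `B`
  have hfBeq : ∀ z, fB z = (vsite B z, pl) := by
    intro z
    obtain ⟨O, hBO, hOB, hO⟩ := exists_outer hL1 (hfB z).2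
    have hOA : O ≠ A := fun h => hn (h ▸ hBO).symm
    obtain ⟨q, hqS, hq, hqO⟩ := H (fB z) (hfB z).1 (vsite O z, 2) hO (ccnt_vsite_of_ne hOA z)
      (ccnt_vsite_of_ne hOB z)
    -- the other plaquette through that link is `fA z`, so `O` is adjacent to `A`
    have hqA : q = fA z ∧ Adj O A :=
      adj_of_fin hfB hfA (fun p hp => (hfins p hp).symm) hOA hqS hq hqO
    have hOM : O = M := eq_bump_of_adj_adj hL ha hqA.2.symm hBO.symm
    rw [hOM] at hO
    exact eq_rung_of_pcnt hL3 pl hpl B (hfB z).2 hO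
  -- hence `band ⊆ S`, and the cardinalities force equality
  have hsub : band B pl ⊆ S := by
    intro p hp
    rcases mem_union.1 hp with hp | hp
    · obtain ⟨z, rfl⟩ := mem_ladder.1 hp
      rw [← hfBeq z]
      exact (hfB z).1
    · obtain ⟨z, rfl⟩ := mem_ladder.1 hp
      rw [← hfAeq z]
      exact (hfA z).1
  exact hS (eq_of_subset_of_card_le hsub (by rw [card_band hL1 B pl hpl]; exact hcard)).symm

end Fins

end DiagRPSUN

end

end Summit.QuantumFields.GaugeBoot
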